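import Summits.ValiantsHypothesis.ValiantsHypothesis.Theorems.FeketeSOSFeketeSOSHardPaleyRIPDefs
import Literature.Analysis.Fourier.DiscreteCantorFUPProofs
import Mathlib.Analysis.Fourier.ZMod
import Mathlib.NumberTheory.LegendreSymbol.Basic

/-!
# Route FeketeSOS — crux `FeketeSOSHard` (stmt-ValiantsHypothesis-3996), line `paley-rip` (v3),
# stub `stub_paleyFlatRIP`: the Hankel–Fourier reduction — on supports inside a SHORT arithmetic
# progression the engine is a bound for twisted SHORT character sums (no completion loss)

The engine `stub_paleyFlatRIP` (PaleyRIP beyond `√p`; a named open problem — Chor–Goldreich 1988 /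
Chung 1994 Conj. 2.2 / Bandeira–Fickus–Mixon–Wong 2013, see `…PaleyGraphConjecture.lean`) asks for
`|Q_p(S,w)| ≤ p^{1/2−κ} Σ_{a∈S}|w_a|²`, `Q_p(S,w) = Σ_{a,b∈S} χ_p(a+b) w_a w_b`, on every `S ⊆ [0,p)` with
`#S ≤ p^{1/2+δ₁}`.  The completion bound (`…PaleyRIPCompletion*`) loses exactly at `√p` because it embeds
`S` in the full cyclic group `ℤ/p`.  This file records the elementary observation that for supports
contained in a short arithmetic progression `{x + j·d (mod p) : j < N}` NO completion to `ℤ/p` is needed: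
the kernel `χ_p(a+b) = χ_p(2x + (j_a + j_b)d)` is a HANKEL kernel in the progression index, so Fourier
analysis on the short cyclic group `ℤ/M`, any `M ≥ 2N − 1`, gives

  `|Q_p(S,w)| ≤ (max_k |Σ_{s<2N−1} χ_p(2x+sd)·e(−sk/M)|) · Σ_{a∈S}|w_a|²`      (`norm_paleyForm_le_of_progression`)

for ALL complex weights `w` — the operator norm of a finite Hankel matrix is at most the sup-norm of its
symbol.  Consequently the engine restricted to AP-contained supports of length `N ≤ p^{1/2+δ₁}` is
EXACTLY a uniform power saving for short character sums with a linear phase ("mixed" sums) of length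
`≍ p^{1/2+δ₁}` — which is a published theorem (Burgess 1988 for `θ = a/p`; Chang 2010; Heath-Brown–Pierce,
J. LMS 91 (2015) Thm 1.4: `≪ H^{1−1/r} p^{1/(4(r−1))+ε}` for `H < p^{1/2+1/(4(r−1))}`, saving up to `1/24`
just above `√p` with `r = 3`).  The conditional corollary is in the sequel file; the Burgess method itself
(Weil bound for hyperelliptic curves) is not in Mathlib.

* `dft_mul_trigSum_sq_sum` — `Σ_k 𝓕c(k)·(Σ_{a∈S} w_a e_M(φ(a)k))² = M·Σ_{a,b∈S} c(φa+φb) w_a w_b`;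
* `sum_norm_sq_trigSum` — Plancherel for `S`-indexed trigonometric sums (`φ` injective on `S`);
* `norm_hankelForm_le_of_dft_bound` — **generic Hankel–Fourier bound**: `‖𝓕c‖_∞ ≤ B` ⇒
  `|Σ_{a,b∈S} c(φa+φb) w_a w_b| ≤ B·Σ_{a∈S}|w_a|²` (any kernel `c : ℤ/M → ℂ`);
* `norm_paleyForm_le_of_progression` — the displayed bound for the Paley–Hankel form;
* `norm_paleyForm_le_of_interval` — the case `d = 1`, `S ⊆ [x, x+N)`.

Honest framing (rung currency): a Theorems-side helper `--supports` stmt-3996.  It proves the engine on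
NO new support class by itself (the twisted-sum bound is the input); it identifies the AP-contained case
of the engine with a theorem in print and corrects the census line "arbitrary sub-pairs `A, B ⊆` interval:
open" of `Cruxes/FeketeSOSHard/Lines/paley-rip-flatRIP-census-g2.md` (the operator-norm bound covers all
weights, hence all sub-pairs).  The engine for general supports, `stub_tameOperator` and the crux stay
OPEN; `VP ≠ VNP` is untouched.
-/

set_option linter.dupNamespace false

namespace Summit.ValiantsHypothesis.ValiantsHypothesis.Theorems.FeketeSOSHardPaleyRIP

open Finset Complex
open scoped BigOperators ZMod

noncomputable section

/-! ## Fourier analysis of Hankel forms on a short cyclic group -/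

section HankelFourier

variable {M : ℕ} [NeZero M]

/-- **Hankel forms through the DFT.**  For a kernel `c : ℤ/M → ℂ`, an index map `φ` and weights `w` on a
finite set `S`: `Σ_k 𝓕c(k) · (Σ_{a∈S} w_a e_M(φ(a)k))² = M · Σ_{a,b∈S} c(φ(a)+φ(b)) w_a w_b`
(orthogonality of the additive characters of `ℤ/M`). [folklore] -/
theorem dft_mul_trigSum_sq_sum (c : ZMod M → ℂ) {α : Type*} (S : Finset α) (φ : α → ZMod M)
    (w : α → ℂ) :
    ∑ k : ZMod M, 𝓕 c k * (∑ a ∈ S, w a * (ZMod.stdAddChar (φ a * k) : ℂ)) ^ 2 =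
      (M : ℂ) * ∑ a ∈ S, ∑ b ∈ S, c (φ a + φ b) * w a * w b := by
  -- expand every term
  have hexp : ∀ k : ZMod M, 𝓕 c k * (∑ a ∈ S, w a * (ZMod.stdAddChar (φ a * k) : ℂ)) ^ 2 =
      ∑ z : ZMod M, ∑ a ∈ S, ∑ b ∈ S,
        c z * w a * w b * (ZMod.stdAddChar ((φ a + φ b - z) * k) : ℂ) := by
    intro k
    rw [ZMod.dft_apply, sq, Finset.sum_mul]
    refine Finset.sum_congr rfl fun z _ => ?_
    rw [smul_eq_mul, Finset.sum_mul_sum, Finset.mul_sum]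
    refine Finset.sum_congr rfl fun a _ => ?_
    rw [Finset.mul_sum]
    refine Finset.sum_congr rfl fun b _ => ?_
    have hchar : (ZMod.stdAddChar (-(z * k)) : ℂ) * ZMod.stdAddChar (φ a * k) *
        ZMod.stdAddChar (φ b * k) = ZMod.stdAddChar ((φ a + φ b - z) * k) := by
      rw [← AddChar.map_add_eq_mul, ← AddChar.map_add_eq_mul]; congr 1; ring
    calc ZMod.stdAddChar (-(z * k)) * c z * (w a * ZMod.stdAddChar (φ a * k) *
          (w b * ZMod.stdAddChar (φ b * k)))
        = c z * w a * w b * ((ZMod.stdAddChar (-(z * k)) : ℂ) * ZMod.stdAddChar (φ a * k) *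
            ZMod.stdAddChar (φ b * k)) := by ring
      _ = _ := by rw [hchar]
  simp_rw [hexp]
  -- move the sum over `k` inside and use orthogonality
  rw [Finset.sum_comm]
  have hin : ∀ z : ZMod M, (∑ k : ZMod M, ∑ a ∈ S, ∑ b ∈ S,
      c z * w a * w b * (ZMod.stdAddChar ((φ a + φ b - z) * k) : ℂ)) =
      ∑ a ∈ S, ∑ b ∈ S, c z * w a * w b * (if φ a + φ b - z = 0 then (M : ℂ) else 0) := by
    intro z
    rw [Finset.sum_comm]
    refine Finset.sum_congr rfl fun a _ => ?_
    rw [Finset.sum_comm]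
    refine Finset.sum_congr rfl fun b _ => ?_
    rw [← Finset.mul_sum, Literature.Analysis.Fourier.sum_stdAddChar_mul]
  simp_rw [hin]
  -- collapse the sum over `z`
  rw [Finset.sum_comm, Finset.mul_sum]
  refine Finset.sum_congr rfl fun a _ => ?_
  rw [Finset.sum_comm, Finset.mul_sum]
  refine Finset.sum_congr rfl fun b _ => ?_
  rw [Finset.sum_eq_single (φ a + φ b)]
  · rw [if_pos (sub_self _)]; ring
  · intro z _ hz
    rw [if_neg (fun h => hz (sub_eq_zero.1 h).symm), mul_zero]
  · intro h; exact absurd (Finset.mem_univ _) h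

/-- **Plancherel for `S`-indexed trigonometric sums**: if `φ` is injective on `S`, then
`Σ_{k ∈ ℤ/M} |Σ_{a∈S} w_a e_M(φ(a)k)|² = M · Σ_{a∈S} |w_a|²`. [folklore] -/
theorem sum_norm_sq_trigSum {α : Type*} (S : Finset α) (φ : α → ZMod M) (hφ : Set.InjOn φ S)
    (w : α → ℂ) :
    ∑ k : ZMod M, ‖∑ a ∈ S, w a * (ZMod.stdAddChar (φ a * k) : ℂ)‖ ^ 2 =
      (M : ℝ) * ∑ a ∈ S, ‖w a‖ ^ 2 := by
  classical
  have key : ∀ k : ZMod M, ((‖∑ a ∈ S, w a * (ZMod.stdAddChar (φ a * k) : ℂ)‖ : ℝ) : ℂ) ^ 2 =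
      ∑ a ∈ S, ∑ a' ∈ S, w a * (starRingEnd ℂ) (w a') * ZMod.stdAddChar ((φ a - φ a') * k) := by
    intro k
    rw [← Complex.mul_conj', map_sum, Finset.sum_mul_sum]
    refine Finset.sum_congr rfl fun a _ => Finset.sum_congr rfl fun a' _ => ?_
    simp only [map_mul, Literature.Analysis.Fourier.conj_stdAddChar]
    have : (ZMod.stdAddChar (φ a * k) : ℂ) * ZMod.stdAddChar (-(φ a' * k))
        = ZMod.stdAddChar ((φ a - φ a') * k) := by
      rw [← AddChar.map_add_eq_mul]; congr 1; ring
    calc w a * ZMod.stdAddChar (φ a * k) * ((starRingEnd ℂ) (w a') * ZMod.stdAddChar (-(φ a' * k)))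
        = w a * (starRingEnd ℂ) (w a') * (ZMod.stdAddChar (φ a * k) * ZMod.stdAddChar (-(φ a' * k))) := by
          ring
      _ = _ := by rw [this]
  apply Complex.ofReal_injective
  push_cast
  simp_rw [key]
  rw [Finset.sum_comm]
  have hin : ∀ a ∈ S, (∑ k : ZMod M, ∑ a' ∈ S,
      w a * (starRingEnd ℂ) (w a') * (ZMod.stdAddChar ((φ a - φ a') * k) : ℂ)) =
      (M : ℂ) * ((‖w a‖ : ℂ) ^ 2) := by
    intro a ha
    rw [Finset.sum_comm]
    have hterm : ∀ a' ∈ S, (∑ k : ZMod M,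
        w a * (starRingEnd ℂ) (w a') * (ZMod.stdAddChar ((φ a - φ a') * k) : ℂ)) =
        if a' = a then (M : ℂ) * ((‖w a‖ : ℂ) ^ 2) else 0 := by
      intro a' ha'
      rw [← Finset.mul_sum, Literature.Analysis.Fourier.sum_stdAddChar_mul]
      by_cases h : a' = a
      · subst h
        rw [if_pos (sub_self _), if_pos rfl, ← Complex.mul_conj']; ring
      · have hne : φ a - φ a' ≠ 0 := fun h0 => h (hφ ha' ha (sub_eq_zero.1 h0).symm)
        rw [if_neg hne, if_neg h, mul_zero]
    rw [Finset.sum_congr rfl hterm, Finset.sum_ite_eq' S a, if_pos ha]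
  rw [Finset.sum_congr rfl hin, ← Finset.mul_sum]

/-- **Generic Hankel–Fourier bound.**  If the discrete Fourier transform of the kernel `c : ℤ/M → ℂ`
is bounded by `B` and `φ` is injective on `S`, then the Hankel-type form satisfies
`|Σ_{a,b∈S} c(φ(a)+φ(b)) w_a w_b| ≤ B · Σ_{a∈S}|w_a|²` for all complex weights — the operator norm of
a Hankel matrix is at most the sup-norm of its symbol. [folklore] -/
theorem norm_hankelForm_le_of_dft_bound (c : ZMod M → ℂ) (B : ℝ) (hB : ∀ k, ‖𝓕 c k‖ ≤ B)
    {α : Type*} (S : Finset α) (φ : α → ZMod M) (hφ : Set.InjOn φ S) (w : α → ℂ) :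
    ‖∑ a ∈ S, ∑ b ∈ S, c (φ a + φ b) * w a * w b‖ ≤ B * ∑ a ∈ S, ‖w a‖ ^ 2 := by
  have hM : (0 : ℝ) < (M : ℝ) := by exact_mod_cast Nat.pos_of_ne_zero (NeZero.ne M)
  set V : ZMod M → ℂ := fun k => ∑ a ∈ S, w a * (ZMod.stdAddChar (φ a * k) : ℂ) with hV
  have key := dft_mul_trigSum_sq_sum c S φ w
  have h1 : (M : ℝ) * ‖∑ a ∈ S, ∑ b ∈ S, c (φ a + φ b) * w a * w b‖ =
      ‖∑ k : ZMod M, 𝓕 c k * V k ^ 2‖ := by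
    rw [hV, key, norm_mul, Complex.norm_natCast]
  have h2 : ‖∑ k : ZMod M, 𝓕 c k * V k ^ 2‖ ≤ ∑ k : ZMod M, B * ‖V k‖ ^ 2 := by
    refine (norm_sum_le _ _).trans (Finset.sum_le_sum fun k _ => ?_)
    rw [norm_mul, norm_pow]
    exact mul_le_mul_of_nonneg_right (hB k) (sq_nonneg _)
  have h3 : ∑ k : ZMod M, B * ‖V k‖ ^ 2 = B * ((M : ℝ) * ∑ a ∈ S, ‖w a‖ ^ 2) := by
    rw [← Finset.mul_sum, hV, sum_norm_sq_trigSum S φ hφ w]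
  have h4 : (M : ℝ) * ‖∑ a ∈ S, ∑ b ∈ S, c (φ a + φ b) * w a * w b‖ ≤
      (M : ℝ) * (B * ∑ a ∈ S, ‖w a‖ ^ 2) := by
    rw [h1]; calc _ ≤ _ := h2
      _ = _ := by rw [h3]; ring
  exact le_of_mul_le_mul_left h4 hM

end HankelFourier

/-! ## The Paley–Hankel form on a support inside a short arithmetic progression -/

section Progression

variable (p : ℕ) [Fact p.Prime]

/-- The Legendre symbol only depends on the residue class: equal casts in `ZMod p` give equal symbols.
[folklore] -/
theorem legendreSym_eq_of_cast_eq {a b : ℤ} (h : (a : ZMod p) = (b : ZMod p)) :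
    legendreSym p a = legendreSym p b := by
  unfold legendreSym; rw [h]

/-- **The engine on AP-contained supports reduces to twisted short character sums.**  Let
`S ⊆ [0,p)` be contained in the progression `{x + j·d (mod p) : j < N}`, let `M ≥ 2N − 1`, and let
`c : ℤ/M → ℂ` agree with `s ↦ χ_p(2x + s·d)` on `s ≤ 2N − 2`.  If `|𝓕c(k)| ≤ B` for all `k`, then
`|Q_p(S,w)| ≤ B · Σ_{a∈S}|w_a|²` for every complex weight `w`.  (With `c` the truncated kernel,
`𝓕c(k) = Σ_{s<2N−1} χ_p(2x+sd) e(−sk/M)`: a character sum of length `2N−1` with a linear phase.)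
[folklore] -/
theorem norm_paleyForm_le_of_progression (S : Finset ℕ) (hS : ∀ a ∈ S, a < p) (x d : ℤ) (N : ℕ)
    (hAP : ∀ a ∈ S, ∃ j : ℕ, j < N ∧ ((a : ℤ) : ZMod p) = (x : ZMod p) + (j : ZMod p) * (d : ZMod p))
    (M : ℕ) [NeZero M] (hM : 2 * N ≤ M + 1) (c : ZMod M → ℂ)
    (hc : ∀ s : ℕ, s + 2 ≤ 2 * N → c (s : ZMod M) = ((legendreSym p (2 * x + (s : ℤ) * d) : ℤ) : ℂ))
    (B : ℝ) (hB : ∀ k, ‖𝓕 c k‖ ≤ B) (w : ℕ → ℂ) :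
    ‖paleyForm p S w‖ ≤ B * ∑ a ∈ S, ‖w a‖ ^ 2 := by
  classical
  -- the progression index of `a ∈ S`
  let ι : ℕ → ℕ := fun a => if h : a ∈ S then Classical.choose (hAP a h) else 0
  have hι : ∀ a ∈ S, ι a < N ∧ ((a : ℤ) : ZMod p) = (x : ZMod p) + (ι a : ZMod p) * (d : ZMod p) := by
    intro a ha
    simp only [ι, dif_pos ha]
    exact Classical.choose_spec (hAP a ha)
  have hMpos : 0 < M := Nat.pos_of_ne_zero (NeZero.ne M)
  let φ : ℕ → ZMod M := fun a => ((ι a : ℕ) : ZMod M)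
  -- `φ` is injective on `S`: equal indices give equal residues mod `p`, and `S ⊆ [0,p)`
  have hφ : Set.InjOn φ S := by
    intro a ha b hb hab
    have hia := (hι a ha).1
    have hib := (hι b hb).1
    have hidx : ι a = ι b := by
      have h1 := (ZMod.natCast_eq_natCast_iff' (ι a) (ι b) M).1 hab
      rwa [Nat.mod_eq_of_lt (by omega), Nat.mod_eq_of_lt (by omega)] at h1
    have hres : ((a : ℕ) : ZMod p) = ((b : ℕ) : ZMod p) := by
      have ha' := (hι a ha).2
      have hb' := (hι b hb).2
      rw [Int.cast_natCast] at ha' hb'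
      rw [ha', hb', hidx]
    have h2 := (ZMod.natCast_eq_natCast_iff' a b p).1 hres
    rwa [Nat.mod_eq_of_lt (hS a ha), Nat.mod_eq_of_lt (hS b hb)] at h2
  -- the kernel is Hankel in the progression index
  have hker : ∀ a ∈ S, ∀ b ∈ S,
      ((legendreSym p ((a : ℤ) + b) : ℤ) : ℂ) = c (φ a + φ b) := by
    intro a ha b hb
    have hsum : φ a + φ b = ((ι a + ι b : ℕ) : ZMod M) := by simp only [φ]; push_cast; ring
    rw [hsum, hc (ι a + ι b) (by have := (hι a ha).1; have := (hι b hb).1; omega)]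
    have hleg : legendreSym p ((a : ℤ) + b) = legendreSym p (2 * x + ((ι a + ι b : ℕ) : ℤ) * d) := by
      apply legendreSym_eq_of_cast_eq
      have ha' := (hι a ha).2
      have hb' := (hι b hb).2
      push_cast at ha' hb' ⊢
      rw [ha', hb']; ring
    rw [hleg]
  have hform : paleyForm p S w = ∑ a ∈ S, ∑ b ∈ S, c (φ a + φ b) * w a * w b := by
    unfold paleyForm
    refine Finset.sum_congr rfl fun a ha => Finset.sum_congr rfl fun b hb => ?_
    rw [hker a ha b hb]
  rw [hform]
  exact norm_hankelForm_le_of_dft_bound c B hB S φ hφ w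

/-- **Interval case** (`d = 1`): if `S ⊆ [x, x+N) ⊆ [0,p)` and `c : ℤ/M → ℂ` (`M ≥ 2N−1`) agrees with
`s ↦ χ_p(2x + s)` on `s ≤ 2N−2` with `|𝓕c| ≤ B`, then `|Q_p(S,w)| ≤ B·Σ_{a∈S}|w_a|²` for all `w`: the
`N × N` Hankel section `(χ_p(a+b))_{a,b∈[x,x+N)}` of the Legendre sequence has operator norm at most the
largest twisted sum `|Σ_{s<2N−1} χ_p(2x+s) e(−sk/M)|`. [folklore] -/
theorem norm_paleyForm_le_of_interval (S : Finset ℕ) (hS : ∀ a ∈ S, a < p) (x N : ℕ)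
    (hI : ∀ a ∈ S, x ≤ a ∧ a < x + N)
    (M : ℕ) [NeZero M] (hM : 2 * N ≤ M + 1) (c : ZMod M → ℂ)
    (hc : ∀ s : ℕ, s + 2 ≤ 2 * N → c (s : ZMod M) = ((legendreSym p (2 * (x : ℤ) + (s : ℤ)) : ℤ) : ℂ))
    (B : ℝ) (hB : ∀ k, ‖𝓕 c k‖ ≤ B) (w : ℕ → ℂ) :
    ‖paleyForm p S w‖ ≤ B * ∑ a ∈ S, ‖w a‖ ^ 2 := by
  refine norm_paleyForm_le_of_progression p S hS (x : ℤ) 1 N ?_ M hM c ?_ B hB w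
  · intro a ha
    refine ⟨a - x, by have := hI a ha; omega, ?_⟩
    have hle := (hI a ha).1
    have : (a : ℤ) = (x : ℤ) + ((a - x : ℕ) : ℤ) * 1 := by push_cast [Nat.cast_sub hle]; ring
    rw [this]; push_cast; ring
  · intro s hs
    rw [hc s hs, mul_one]

/-- Sums over `ℤ/M` are sums over the representatives `0 ≤ s < M`. [folklore] -/
theorem sum_zmod_eq_sum_range {M : ℕ} [NeZero M] (f : ZMod M → ℂ) :
    ∑ j : ZMod M, f j = ∑ s ∈ Finset.range M, f (s : ZMod M) := by
  refine Finset.sum_nbij' (fun j : ZMod M => j.val) (fun s : ℕ => (s : ZMod M)) ?_ ?_ ?_ ?_ ?_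
  · intro j _; exact Finset.mem_range.2 (ZMod.val_lt j)
  · intro s _; exact Finset.mem_univ _
  · intro j _; exact ZMod.natCast_zmod_val j
  · intro s hs; rw [ZMod.val_natCast, Nat.mod_eq_of_lt (Finset.mem_range.1 hs)]
  · intro j _; rw [ZMod.natCast_zmod_val]

/-- **Twisted-sum form.**  For `S ⊆ [0,p)` inside the progression `{x + j·d (mod p) : j < N}` and any
modulus `M ≥ 2N − 1`: if every twisted short character sum
`Σ_{s<2N−1} χ_p(2x + s·d) · e(−sk/M)` (`k ∈ ℤ/M`) has modulus `≤ B`, then `|Q_p(S,w)| ≤ B·Σ_{a∈S}|w_a|²`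
for every complex weight `w` (the truncated Hankel kernel in `norm_paleyForm_le_of_progression`).
[folklore] -/
theorem norm_paleyForm_le_of_progression_twisted (S : Finset ℕ) (hS : ∀ a ∈ S, a < p) (x d : ℤ)
    (N : ℕ)
    (hAP : ∀ a ∈ S, ∃ j : ℕ, j < N ∧ ((a : ℤ) : ZMod p) = (x : ZMod p) + (j : ZMod p) * (d : ZMod p))
    (M : ℕ) [NeZero M] (hM : 2 * N ≤ M + 1) (B : ℝ)
    (hB : ∀ k : ZMod M, ‖∑ s ∈ Finset.range (2 * N - 1),
        ((legendreSym p (2 * x + (s : ℤ) * d) : ℤ) : ℂ) * (ZMod.stdAddChar (-((s : ZMod M) * k)) : ℂ)‖ ≤ B)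
    (w : ℕ → ℂ) :
    ‖paleyForm p S w‖ ≤ B * ∑ a ∈ S, ‖w a‖ ^ 2 := by
  -- the truncated kernel on `ℤ/M`
  let c : ZMod M → ℂ := fun z =>
    if z.val + 2 ≤ 2 * N then ((legendreSym p (2 * x + (z.val : ℤ) * d) : ℤ) : ℂ) else 0
  have hval : ∀ s : ℕ, s + 2 ≤ 2 * N → ((s : ℕ) : ZMod M).val = s := by
    intro s hs; rw [ZMod.val_natCast, Nat.mod_eq_of_lt (by omega)]
  have hc : ∀ s : ℕ, s + 2 ≤ 2 * N →
      c (s : ZMod M) = ((legendreSym p (2 * x + (s : ℤ) * d) : ℤ) : ℂ) := by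
    intro s hs
    simp only [c, hval s hs, if_pos hs]
  refine norm_paleyForm_le_of_progression p S hS x d N hAP M hM c hc B (fun k => ?_) w
  -- `𝓕c(k)` is the twisted sum of length `2N − 1`
  have hdft : 𝓕 c k = ∑ s ∈ Finset.range (2 * N - 1),
      ((legendreSym p (2 * x + (s : ℤ) * d) : ℤ) : ℂ) * (ZMod.stdAddChar (-((s : ZMod M) * k)) : ℂ) := by
    rw [ZMod.dft_apply, sum_zmod_eq_sum_range]
    symm
    rw [← Finset.sum_subset (Finset.range_subset_range.2 (show 2 * N - 1 ≤ M by omega))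
      (f := fun s : ℕ => ZMod.stdAddChar (-((s : ZMod M) * k)) • c (s : ZMod M))]
    · refine Finset.sum_congr rfl fun s hs => ?_
      have hs2 : s + 2 ≤ 2 * N := by have := Finset.mem_range.1 hs; omega
      rw [smul_eq_mul, hc s hs2, mul_comm]
    · intro s hsM hs
      have hs' : ¬ (s + 2 ≤ 2 * N) := fun h => hs (Finset.mem_range.2 (by omega))
      have hv : ((s : ℕ) : ZMod M).val = s := by
        rw [ZMod.val_natCast, Nat.mod_eq_of_lt (Finset.mem_range.1 hsM)]
      have : c (s : ZMod M) = 0 := by simp only [c, hv, if_neg hs']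
      rw [smul_eq_mul, this, mul_zero]
  rw [hdft]
  exact hB k

end Progression

end

end Summit.ValiantsHypothesis.ValiantsHypothesis.Theorems.FeketeSOSHardPaleyRIP
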